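import Summits.BirchSwinnertonDyer.BirchSwinnertonDyer.Theorems.PrintCf2SplitBadEisensteinTwoDivisibilitiesCore
import HarnessLib

/-!
# Crux `PrintCf2.SplitBadTwoRankOneOfFacts` (item 20368), line `eisenstein_two_bdp_line` v9 — WHAT EACH ONE-SIDED STUB BUYS AT `T = 0`:
# UPPER divisibility + control socket ⟹ the `2`-adic UPPER bound `ord₂ #Ш(E/K)[2^∞] + ord₂ ∏_w c_w ≤ 2·ord₂ [E(K):ℤP] − 2·ord₂ c`;
# LOWER divisibility + control socket ⟹ the matching LOWER bound (both at one Heegner datum, every class member, no normalisation of `Q`)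

Cell `bsd-print-cf2`, seat `bsd-line-cf2-p1` g7 (LEAD on crux stmt-BirchSwinnertonDyer-20368). `--supports stmt-BirchSwinnertonDyer-20368`
(helper). Theses-free; THEOREMS ONLY (0 definitions, 0 named facts, 0 `sorry`); CONDITIONAL on every displayed hypothesis (`hL` =
Liu–Zhang–Zhang additive; the frame; the one-sided divisibility; the control socket `SchneiderFree.AdditiveControlOnTreeAt 2` at `𝔭′`, a theorem
modulo the torsion-finiteness atoms + Poitou–Tate by p625474). BSD is proved for no curve by any of this; no summit statement is proved by this seat.

The registered v9 stubs `stub_upperDivisibility_two` / `stub_lowerDivisibility_two` are Λ-adic and one-sided. This file records their exact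
`T = 0` content, so that a critic can check that NEITHER is `BSD₂`-valued (each gives ONE inequality of the `K`-side `2`-part) and so that a partial
result (one stub landed) has a quotable theorem: with the socket's formula
`n = ord₂ #Ш(E/K)[2^∞] + 2·(ord₂ log_ω P − ord₂ [E(K):ℤP]) + ord₂ ∏_{w ∣ N} c_w` and the one-sided cores of p628661
(`n ≤ 2·ord₂ log_ω P − 2·ord₂ c`, resp. `≥`), the logarithm CANCELS:
* §1 `sha_add_tamagawa_le_of_upperDivisibility_two` — UPPER: `ord₂ #Ш(E/K)[2^∞] + ord₂ ∏_w c_w(E/K) ≤ 2·ord₂ [E(K):ℤP] − 2·ord₂ c` (Kolyvagin's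
  `2`-adic bound with Manin constant, at the split additive prime `2`, for the CM class — itself not in print at `2`);
* §2 `sha_add_tamagawa_ge_of_lowerDivisibility_two` — LOWER: the reverse inequality;
* §3 `sha_add_tamagawa_eq_of_divisibilities_two` — both ⟹ the exact `K`-side identity consumed by the row kernel (p629097).

References: [Kolyvagin1990] Thm. A (shape of the upper bound); [JetchevSkinnerWan2017] §7.4.1, Thm. 3.3.1; [GrossZagier1986] V.(2.2);
[LiuZhangZhang2018] Thm 1.5.1/1.5.3.
-/

set_option autoImplicit false

-- D-0017 layout: summit = sub-problem, so `Summit.BirchSwinnertonDyer.BirchSwinnertonDyer.…` is the mandated namespace of Theorems files.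
set_option linter.dupNamespace false

noncomputable section

open scoped Classical MatrixGroups ModularForm Topology NumberField

namespace Summit.BirchSwinnertonDyer.BirchSwinnertonDyer.Theorems.PrintCf2.EisensteinTwo

open Filter CongruenceSubgroup WeierstrassCurve NumberField IsDedekindDomain Field PowerSeries
  Literature.NumberTheory.EllipticCurves Literature.NumberTheory.EllipticCurves.ModularForms
  Literature.NumberTheory.EllipticCurves.LiuZhangZhang2018 Literature.NumberTheory.EllipticCurves.Rank1Residual
  Literature.NumberTheory.EllipticCurves.Rank1Residual.Typed Literature.NumberTheory.EllipticCurves.KrizLi2019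
  Literature.NumberTheory.GaloisRepresentations Literature.NumberTheory.GaloisCohomology
  Summit.BirchSwinnertonDyer.Rank1Residual Summit.BirchSwinnertonDyer.Rank1Residual.X11b
  Summit.BirchSwinnertonDyer.Rank1Residual.X11b.AcSelmer Summit.BirchSwinnertonDyer.Rank1Residual.X11b.CongruenceLimit
  Summit.BirchSwinnertonDyer.Rank1Residual.X11b.Halves Summit.BirchSwinnertonDyer.Rank1Residual.X2
  Summit.BirchSwinnertonDyer.Rank1Residual.Additive
  Summit.BirchSwinnertonDyer.BirchSwinnertonDyer.Theses.UniversalToricDescent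
  Summit.BirchSwinnertonDyer.BirchSwinnertonDyer.Theorems.UniversalToricDescentWaldspurgerFlat

/-! ### §1 UPPER divisibility + socket ⟹ Kolyvagin's `2`-adic upper bound on `Ш(E/K)[2^∞]` -/

/-- **UPPER divisibility + control socket ⟹ `ord₂ #Ш(E/K)[2^∞] + ord₂ ∏_w c_w(E/K) ≤ 2·ord₂ [E(K):ℤP] − 2·ord₂ c`.** Data: `W/ℚ` globally
minimal with `4 ∣ N_W`; a Heegner field `K` (`d_K < −4`, Heegner hypothesis for `N_W`) with Heegner datum `(Dt, H, ι_K, P)`, `P` non-torsion,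
`rank E(K) = 1`; `(κ, γ)` anticyclotomic at `2`; degree-one primes `𝔭 ≠ 𝔭′` above `2`; `ι′` inducing `𝔭`; an UN-HALVED ♭-frame `(Ω_K′, Ω_p′, Q)`;
the UPPER divisibility `(Q) ⊆ (h)·Ch·𝓞⟦T⟧`, `‖h(0)‖ ≤ 1/2`, at `𝔭′`; and the control socket at `𝔭′` (`SchneiderFree.AdditiveControlOnTreeAt 2`). The
`2`-adic logarithm of `P` cancels between the socket's formula and the upper core (p628661). This is the `T = 0` content of the registered v9 stub
`stub_upperDivisibility_two`: ONE inequality of the `K`-side `2`-part of BSD, not `BSD₂`. CONDITIONAL on `hL`.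
[cite: Kolyvagin1990, Thm. A (shape)] [cite: JetchevSkinnerWan2017, Thm. 3.3.1 (arXiv:1512.06894 p. 11) (the control formula)] -/
theorem sha_add_tamagawa_le_of_upperDivisibility_two
    (hL : thm151_thm153_modularCurve_heegnerVector_additive)
    (W : WeierstrassCurve ℚ) [W.IsElliptic] [W.IsGloballyMinimal]
    (K : Type) [Field K] [NumberField K]
    (κ : ZpExtension K 2) (γ : absoluteGaloisGroup K) [Fact (κ.IsTopGenerator γ)] {N : ℕ} [NeZero N]
    (Dt : ModularParametrizationData W N) (H : HeegnerDatum N (NumberField.discr K))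
    (ιK : K →+* ℂ) (P : (W.baseChange K).toAffine.Point)
    (hN : W.conductorNorm ℤ = N) (h4N : 2 ^ 2 ∣ N) (hK : IsImaginaryQuadratic K)
    (hd4 : NumberField.discr K < -4) (hHN : SatisfiesHeegnerHypothesis N K) (hκ : κ.IsAnticyclotomic)
    (hP : WeierstrassCurve.Affine.Point.map ιK.toRatAlgHom P = heegnerPointComplex Dt H)
    (hPinf : ¬ IsOfFinAddOrder P) (hrk : (W.baseChange K).mordellWeilRank = 1)
    (𝔭 : HeightOneSpectrum (𝓞 K)) (h𝔭 : ((2 : ℕ) : 𝓞 K) ∈ 𝔭.asIdeal) (he : 𝔭.asIdeal.ramificationIdx (𝓞 ℚ) = 1)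
    (hf : 𝔭.asIdeal.inertiaDeg (𝓞 ℚ) = 1)
    (𝔭' : HeightOneSpectrum (𝓞 K)) (h𝔭' : ((2 : ℕ) : 𝓞 K) ∈ 𝔭'.asIdeal) (he' : 𝔭'.asIdeal.ramificationIdx (𝓞 ℚ) = 1)
    (hf' : 𝔭'.asIdeal.inertiaDeg (𝓞 ℚ) = 1)
    (ι' : PadicAlgCl 2 ≃+* ℂ) (hind : SchneiderFree.BranchInducesPrime 2 ι' 𝔭)
    {ΩK' : ℂ} {Ωp' : ℂ_[2]} {Q : PowerSeries (PadicComplexInt 2)} (hΩK' : ΩK' ≠ 0) (hΩp' : Ωp' ≠ 0)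
    (hQ : R1.IsBDPLFunctionInt 2 ι' 𝔭 κ γ Dt.f ΩK' Ωp' Q)
    (hU : ∃ h : PowerSeries (PadicComplexInt 2), ‖((constantCoeff h : PadicComplexInt 2) : ℂ_[2])‖ ≤ 2⁻¹ ∧
      Ideal.span {Q} ≤ Ideal.span {h} * (XAc.charIdeal (W.baseChange K) 2 κ 𝔭' ∅ γ).map (PowerSeries.map (R1.toCpInt 2)))
    (hctl : SchneiderFree.AdditiveControlOnTreeAt 2 κ 𝔭' γ (embAt K 2 𝔭' h𝔭' he' hf') P) :
    (padicValNat 2 (Nat.card (AddCommGroup.primaryComponent (W.baseChange K).sha 2)) : ℤ) +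
        (padicValNat 2 (W.baseChange K).tamagawaProduct : ℤ) ≤
      2 * (padicValNat 2 (AddSubgroup.zmultiples P).index : ℤ) - 2 * (padicValNat 2 Dt.c.natAbs : ℤ) := by
  obtain ⟨n, hn, hnf⟩ := hctl
  rw [X11b.padicValNat_tamagawaProductSplit_eq_of_heegner_prime W K 2 hN hHN] at hnf
  have hcore := charExponent_le_of_upperDivisibility_two hL W K κ γ Dt H ιK P hN h4N hK hd4 hHN hκ hP hPinf hrk 𝔭 h𝔭 he hf 𝔭' h𝔭'
    he' hf' ι' hind hΩK' hΩp' hQ hn hU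
  linarith

/-! ### §2 LOWER divisibility + socket ⟹ the `2`-adic lower bound -/

/-- **LOWER divisibility + control socket ⟹ `2·ord₂ [E(K):ℤP] − 2·ord₂ c ≤ ord₂ #Ш(E/K)[2^∞] + ord₂ ∏_w c_w(E/K)`.** Same data with the
LOWER divisibility `(g)·Ch·𝓞⟦T⟧ ⊆ (Q)`, `‖g(0)‖ ≥ 1/2`, at `𝔭′` (the `T = 0` content of the registered v9 stub `stub_lowerDivisibility_two`: the
Eisenstein-congruence inequality). CONDITIONAL on `hL`. [cite: JetchevSkinnerWan2017, §7.4.1 (arXiv:1512.06894 p. 30) (shape)] -/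
theorem sha_add_tamagawa_ge_of_lowerDivisibility_two
    (hL : thm151_thm153_modularCurve_heegnerVector_additive)
    (W : WeierstrassCurve ℚ) [W.IsElliptic] [W.IsGloballyMinimal]
    (K : Type) [Field K] [NumberField K]
    (κ : ZpExtension K 2) (γ : absoluteGaloisGroup K) [Fact (κ.IsTopGenerator γ)] {N : ℕ} [NeZero N]
    (Dt : ModularParametrizationData W N) (H : HeegnerDatum N (NumberField.discr K))
    (ιK : K →+* ℂ) (P : (W.baseChange K).toAffine.Point)
    (hN : W.conductorNorm ℤ = N) (h4N : 2 ^ 2 ∣ N) (hK : IsImaginaryQuadratic K)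
    (hd4 : NumberField.discr K < -4) (hHN : SatisfiesHeegnerHypothesis N K) (hκ : κ.IsAnticyclotomic)
    (hP : WeierstrassCurve.Affine.Point.map ιK.toRatAlgHom P = heegnerPointComplex Dt H)
    (hPinf : ¬ IsOfFinAddOrder P) (hrk : (W.baseChange K).mordellWeilRank = 1)
    (𝔭 : HeightOneSpectrum (𝓞 K)) (h𝔭 : ((2 : ℕ) : 𝓞 K) ∈ 𝔭.asIdeal) (he : 𝔭.asIdeal.ramificationIdx (𝓞 ℚ) = 1)
    (hf : 𝔭.asIdeal.inertiaDeg (𝓞 ℚ) = 1)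
    (𝔭' : HeightOneSpectrum (𝓞 K)) (h𝔭' : ((2 : ℕ) : 𝓞 K) ∈ 𝔭'.asIdeal) (he' : 𝔭'.asIdeal.ramificationIdx (𝓞 ℚ) = 1)
    (hf' : 𝔭'.asIdeal.inertiaDeg (𝓞 ℚ) = 1)
    (ι' : PadicAlgCl 2 ≃+* ℂ) (hind : SchneiderFree.BranchInducesPrime 2 ι' 𝔭)
    {ΩK' : ℂ} {Ωp' : ℂ_[2]} {Q : PowerSeries (PadicComplexInt 2)} (hΩK' : ΩK' ≠ 0) (hΩp' : Ωp' ≠ 0)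
    (hQ : R1.IsBDPLFunctionInt 2 ι' 𝔭 κ γ Dt.f ΩK' Ωp' Q)
    (hLo : ∃ g : PowerSeries (PadicComplexInt 2), 2⁻¹ ≤ ‖((constantCoeff g : PadicComplexInt 2) : ℂ_[2])‖ ∧
      Ideal.span {g} * (XAc.charIdeal (W.baseChange K) 2 κ 𝔭' ∅ γ).map (PowerSeries.map (R1.toCpInt 2)) ≤ Ideal.span {Q})
    (hctl : SchneiderFree.AdditiveControlOnTreeAt 2 κ 𝔭' γ (embAt K 2 𝔭' h𝔭' he' hf') P) :
    2 * (padicValNat 2 (AddSubgroup.zmultiples P).index : ℤ) - 2 * (padicValNat 2 Dt.c.natAbs : ℤ) ≤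
      (padicValNat 2 (Nat.card (AddCommGroup.primaryComponent (W.baseChange K).sha 2)) : ℤ) +
        (padicValNat 2 (W.baseChange K).tamagawaProduct : ℤ) := by
  obtain ⟨n, hn, hnf⟩ := hctl
  rw [X11b.padicValNat_tamagawaProductSplit_eq_of_heegner_prime W K 2 hN hHN] at hnf
  have hcore := charExponent_ge_of_lowerDivisibility_two hL W K κ γ Dt H ιK P hN h4N hK hd4 hHN hκ hP hPinf hrk 𝔭 h𝔭 he hf 𝔭' h𝔭'
    he' hf' ι' hind hΩK' hΩp' hQ hn hLo
  linarith

/-! ### §3 Both ⟹ the exact `K`-side identity -/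

/-- **Both divisibilities + control socket ⟹ `ord₂ #Ш(E/K)[2^∞] + ord₂ ∏_w c_w(E/K) = 2·ord₂ [E(K):ℤP] − 2·ord₂ c`** — the exact `K`-side
`2`-part identity that the row kernel (p629097) feeds into cell bsd-p2's over-`K` road; recorded here as the conjunction of §1 and §2.
[cite: GrossZagier1986, V.(2.2)] [cite: JetchevSkinnerWan2017, Thm. 3.3.1 (shape)] -/
theorem sha_add_tamagawa_eq_of_divisibilities_two
    (hL : thm151_thm153_modularCurve_heegnerVector_additive)
    (W : WeierstrassCurve ℚ) [W.IsElliptic] [W.IsGloballyMinimal]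
    (K : Type) [Field K] [NumberField K]
    (κ : ZpExtension K 2) (γ : absoluteGaloisGroup K) [Fact (κ.IsTopGenerator γ)] {N : ℕ} [NeZero N]
    (Dt : ModularParametrizationData W N) (H : HeegnerDatum N (NumberField.discr K))
    (ιK : K →+* ℂ) (P : (W.baseChange K).toAffine.Point)
    (hN : W.conductorNorm ℤ = N) (h4N : 2 ^ 2 ∣ N) (hK : IsImaginaryQuadratic K)
    (hd4 : NumberField.discr K < -4) (hHN : SatisfiesHeegnerHypothesis N K) (hκ : κ.IsAnticyclotomic)
    (hP : WeierstrassCurve.Affine.Point.map ιK.toRatAlgHom P = heegnerPointComplex Dt H)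
    (hPinf : ¬ IsOfFinAddOrder P) (hrk : (W.baseChange K).mordellWeilRank = 1)
    (𝔭 : HeightOneSpectrum (𝓞 K)) (h𝔭 : ((2 : ℕ) : 𝓞 K) ∈ 𝔭.asIdeal) (he : 𝔭.asIdeal.ramificationIdx (𝓞 ℚ) = 1)
    (hf : 𝔭.asIdeal.inertiaDeg (𝓞 ℚ) = 1)
    (𝔭' : HeightOneSpectrum (𝓞 K)) (h𝔭' : ((2 : ℕ) : 𝓞 K) ∈ 𝔭'.asIdeal) (he' : 𝔭'.asIdeal.ramificationIdx (𝓞 ℚ) = 1)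
    (hf' : 𝔭'.asIdeal.inertiaDeg (𝓞 ℚ) = 1)
    (ι' : PadicAlgCl 2 ≃+* ℂ) (hind : SchneiderFree.BranchInducesPrime 2 ι' 𝔭)
    {ΩK' : ℂ} {Ωp' : ℂ_[2]} {Q : PowerSeries (PadicComplexInt 2)} (hΩK' : ΩK' ≠ 0) (hΩp' : Ωp' ≠ 0)
    (hQ : R1.IsBDPLFunctionInt 2 ι' 𝔭 κ γ Dt.f ΩK' Ωp' Q)
    (hU : ∃ h : PowerSeries (PadicComplexInt 2), ‖((constantCoeff h : PadicComplexInt 2) : ℂ_[2])‖ ≤ 2⁻¹ ∧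
      Ideal.span {Q} ≤ Ideal.span {h} * (XAc.charIdeal (W.baseChange K) 2 κ 𝔭' ∅ γ).map (PowerSeries.map (R1.toCpInt 2)))
    (hLo : ∃ g : PowerSeries (PadicComplexInt 2), 2⁻¹ ≤ ‖((constantCoeff g : PadicComplexInt 2) : ℂ_[2])‖ ∧
      Ideal.span {g} * (XAc.charIdeal (W.baseChange K) 2 κ 𝔭' ∅ γ).map (PowerSeries.map (R1.toCpInt 2)) ≤ Ideal.span {Q})
    (hctl : SchneiderFree.AdditiveControlOnTreeAt 2 κ 𝔭' γ (embAt K 2 𝔭' h𝔭' he' hf') P) :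
    (padicValNat 2 (Nat.card (AddCommGroup.primaryComponent (W.baseChange K).sha 2)) : ℤ) +
        (padicValNat 2 (W.baseChange K).tamagawaProduct : ℤ) =
      2 * (padicValNat 2 (AddSubgroup.zmultiples P).index : ℤ) - 2 * (padicValNat 2 Dt.c.natAbs : ℤ) :=
  le_antisymm
    (sha_add_tamagawa_le_of_upperDivisibility_two hL W K κ γ Dt H ιK P hN h4N hK hd4 hHN hκ hP hPinf hrk 𝔭 h𝔭 he hf 𝔭' h𝔭' he' hf' ι'
      hind hΩK' hΩp' hQ hU hctl)
    (sha_add_tamagawa_ge_of_lowerDivisibility_two hL W K κ γ Dt H ιK P hN h4N hK hd4 hHN hκ hP hPinf hrk 𝔭 h𝔭 he hf 𝔭' h𝔭' he' hf' ι'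
      hind hΩK' hΩp' hQ hLo hctl)

end Summit.BirchSwinnertonDyer.BirchSwinnertonDyer.Theorems.PrintCf2.EisensteinTwo

end
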